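import Mathlib
import HarnessLib
import Literature.NumberTheory.Transcendental.AssociatorsBarEval
import Summits.KontsevichZagierPeriods.KontsevichZagierPeriods.Theorems.FurushoPentagonKernelModuloPeriodConjectureLeafLowWeight
import Summits.KontsevichZagierPeriods.KontsevichZagierPeriods.Theorems.FurushoPentagonKernelModuloPeriodConjectureLeafCert
import Summits.KontsevichZagierPeriods.KontsevichZagierPeriods.Theorems.FurushoPentagonKernelModuloPeriodConjectureLeafTableLow
import Summits.KontsevichZagierPeriods.KontsevichZagierPeriods.Theorems.FurushoPentagonKernelModuloPeriodConjectureLeafWeightFiveA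

/-!
# `KernelModuloPeriodConjecture`, line `Sketch`: the algebraic leaf in weight 5

Crux `FurushoPentagon.KernelModuloPeriodConjecture` (stmt-KontsevichZagierPeriods-15058), line
`Sketch`, registered stub `stub_associatorHoffmanSpanning` (the algebraic leaf
`AssociatorHoffmanSpanning`: Hoffman words span `𝒪(GroupLike ∩ Pent)` weight by weight). This file
proves the **weight-5 slice** unconditionally: for every admissible index `s` of weight 5 an
explicit rational certificate `c_{binaryWord s}(φ) = Σ_t b_t c_{binaryWord t}(φ)` (`t` Hoffman of
the same weight), valid at every group-like solution `φ` of Drinfeld's pentagon equation over every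
commutative `ℚ`-algebra (`associatorHoffmanSpanning_of_weight_eq_5`; the identity tables are the part files).

Method. For such `φ`: (i) `c_{x₁}(φ) = 0`, `c_{x₁ⁿ}(φ) = 0` (pentagon:
`DrinfeldPentagon.apply_letter_eq_zero_of_isGroupLike`, `IsGroupLike.apply_replicate_eq_zero`);
(ii) shuffle products `c_u c_v = Σ_{w ∈ u ш v} c_w` (group-likeness), used for `u = x₁`
(regularisation of the words `x₁w`) and for pairs of convergent words (finite double shuffle);
(iii) the regularised stuffle identities `π_Y(φ)(s) π_Y(φ)(t) = Σ_{u ∈ s ∗ t} π_Y(φ)(u)` for `s`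
admissible and `t = (1,…,1)` or `t` admissible — Furusho's double shuffle for pentagon solutions in
the coefficientwise form `DrinfeldPentagon.piY_mul_piY_eq_sum_stuffle` (tree theorem; Furusho 2011,
§5). Products of lower-weight coefficients are rewritten through the lower-weight tables; the
resulting linear system in the coefficients `c_w`, `w ∈ {x₀,x₁}^{k-1}x₁`, and in the products of
Hoffman coefficients has corank `d_k` (Zagier's dimension) with the Hoffman words free — the
Ihara–Kaneko–Zagier verification of their Conjecture 1 in this weight, here for abstract pentagon
solutions. Certificates were found by exact linear algebra over `ℚ` (lead's generator
`work/gen/genlean.py`, folder of prover-line-stmt-KontsevichZagierPeriods-15058-c1) and are checked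
by `linear_combination`; denominators are cleared (`D · c_w = Σ n_t c_t`).

References: K. Ihara, M. Kaneko, D. Zagier, *Derivation and double shuffle relations for multiple
zeta values*, Compos. Math. 142 (2006), §1–§2 [IharaKanekoZagier2006]; H. Furusho, *Double shuffle
relation for associators*, Ann. of Math. 174 (2011), Thm 1.2, §5 [Furusho2011]; F. Brown, *Mixed
Tate motives over ℤ*, Ann. of Math. 175 (2012), Thm 1.1 [Brown2012].
-/

namespace Summit.KontsevichZagierPeriods.FurushoPentagon.KernelModuloPeriodConjecture

open Literature.NumberTheory.Transcendental

/-- The algebraic leaf for `s = (2,1,1,1)` (at `Φ_KZ`: `ζ(2,1,1,1) = 6/5 ζ(2,3) + 4/5 ζ(3,2)`).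
[cite: IharaKanekoZagier2006, §2] -/
theorem leafCert_w5_2111 :
    ∃ b : List ℕ →₀ ℚ, (∀ t ∈ b.support, MZV.IsHoffman t ∧ MZV.weight t = MZV.weight [2, 1, 1, 1]) ∧
      ∀ (R : Type) [CommRing R] [Algebra ℚ R] [IsReduced R] (φ : NCSeries Bool R),
      NCSeries.IsGroupLike φ → NCSeries.DrinfeldPentagon φ → φ (MZV.binaryWord [2, 1, 1, 1]) = b.sum
      (fun t q => q • φ (MZV.binaryWord t)) :=
  leafCert_exists [2, 1, 1, 1] 5 (by norm_num) [([2, 3], 6), ([3, 2], 4)] (by decide) fun R _ _ φ hg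
    h5 => by
    have h := leafNF_01111 hg h5
    simp only [List.map_cons, List.map_nil, List.sum_cons, List.sum_nil, add_zero]
    push_cast
    rw [show MZV.binaryWord [2, 1, 1, 1] = [false, true, true, true, true] from by decide,
      show MZV.binaryWord [2, 3] = [false, true, false, false, true] from by decide,
      show MZV.binaryWord [3, 2] = [false, false, true, false, true] from by decide]
    linear_combination h

/-- The algebraic leaf for `s = (2,1,2)` (at `Φ_KZ`: `ζ(2,1,2) = 1 ζ(2,3)`). [cite:
IharaKanekoZagier2006, §2] -/
theorem leafCert_w5_212 :
    ∃ b : List ℕ →₀ ℚ, (∀ t ∈ b.support, MZV.IsHoffman t ∧ MZV.weight t = MZV.weight [2, 1, 2]) ∧ ∀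
      (R : Type) [CommRing R] [Algebra ℚ R] [IsReduced R] (φ : NCSeries Bool R),
      NCSeries.IsGroupLike φ → NCSeries.DrinfeldPentagon φ → φ (MZV.binaryWord [2, 1, 2]) = b.sum
      (fun t q => q • φ (MZV.binaryWord t)) :=
  leafCert_exists [2, 1, 2] 1 (by norm_num) [([2, 3], -1)] (by decide) fun R _ _ φ hg h5 => by
    have h := leafNF_01101 hg h5
    simp only [List.map_cons, List.map_nil, List.sum_cons, List.sum_nil, add_zero]
    push_cast
    rw [show MZV.binaryWord [2, 1, 2] = [false, true, true, false, true] from by decide,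
      show MZV.binaryWord [2, 3] = [false, true, false, false, true] from by decide]
    linear_combination h

/-- The algebraic leaf for `s = (2,2,1)` (at `Φ_KZ`: `ζ(2,2,1) = 1 ζ(3,2)`). [cite:
IharaKanekoZagier2006, §2] -/
theorem leafCert_w5_221 :
    ∃ b : List ℕ →₀ ℚ, (∀ t ∈ b.support, MZV.IsHoffman t ∧ MZV.weight t = MZV.weight [2, 2, 1]) ∧ ∀
      (R : Type) [CommRing R] [Algebra ℚ R] [IsReduced R] (φ : NCSeries Bool R),
      NCSeries.IsGroupLike φ → NCSeries.DrinfeldPentagon φ → φ (MZV.binaryWord [2, 2, 1]) = b.sum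
      (fun t q => q • φ (MZV.binaryWord t)) :=
  leafCert_exists [2, 2, 1] 1 (by norm_num) [([3, 2], -1)] (by decide) fun R _ _ φ hg h5 => by
    have h := leafNF_01011 hg h5
    simp only [List.map_cons, List.map_nil, List.sum_cons, List.sum_nil, add_zero]
    push_cast
    rw [show MZV.binaryWord [2, 2, 1] = [false, true, false, true, true] from by decide,
      show MZV.binaryWord [3, 2] = [false, false, true, false, true] from by decide]
    linear_combination h

/-- The algebraic leaf for `s = (3,1,1)` (at `Φ_KZ`: `ζ(3,1,1) = 1/5 ζ(2,3) - 1/5 ζ(3,2)`). [cite: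
IharaKanekoZagier2006, §2] -/
theorem leafCert_w5_311 :
    ∃ b : List ℕ →₀ ℚ, (∀ t ∈ b.support, MZV.IsHoffman t ∧ MZV.weight t = MZV.weight [3, 1, 1]) ∧ ∀
      (R : Type) [CommRing R] [Algebra ℚ R] [IsReduced R] (φ : NCSeries Bool R),
      NCSeries.IsGroupLike φ → NCSeries.DrinfeldPentagon φ → φ (MZV.binaryWord [3, 1, 1]) = b.sum
      (fun t q => q • φ (MZV.binaryWord t)) :=
  leafCert_exists [3, 1, 1] 5 (by norm_num) [([2, 3], -1), ([3, 2], 1)] (by decide) fun R _ _ φ hg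
    h5 => by
    have h := leafNF_00111 hg h5
    simp only [List.map_cons, List.map_nil, List.sum_cons, List.sum_nil, add_zero]
    push_cast
    rw [show MZV.binaryWord [3, 1, 1] = [false, false, true, true, true] from by decide,
      show MZV.binaryWord [2, 3] = [false, true, false, false, true] from by decide,
      show MZV.binaryWord [3, 2] = [false, false, true, false, true] from by decide]
    linear_combination h

/-- The algebraic leaf for `s = (4,1)` (at `Φ_KZ`: `ζ(4,1) = 1/5 ζ(2,3) - 1/5 ζ(3,2)`). [cite:
IharaKanekoZagier2006, §2] -/
theorem leafCert_w5_41 :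
    ∃ b : List ℕ →₀ ℚ, (∀ t ∈ b.support, MZV.IsHoffman t ∧ MZV.weight t = MZV.weight [4, 1]) ∧ ∀ (R
      : Type) [CommRing R] [Algebra ℚ R] [IsReduced R] (φ : NCSeries Bool R), NCSeries.IsGroupLike φ
      → NCSeries.DrinfeldPentagon φ → φ (MZV.binaryWord [4, 1]) = b.sum (fun t q => q • φ
      (MZV.binaryWord t)) :=
  leafCert_exists [4, 1] 5 (by norm_num) [([2, 3], 1), ([3, 2], -1)] (by decide) fun R _ _ φ hg h5
    => by
    have h := leafNF_00011 hg h5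
    simp only [List.map_cons, List.map_nil, List.sum_cons, List.sum_nil, add_zero]
    push_cast
    rw [show MZV.binaryWord [4, 1] = [false, false, false, true, true] from by decide,
      show MZV.binaryWord [2, 3] = [false, true, false, false, true] from by decide,
      show MZV.binaryWord [3, 2] = [false, false, true, false, true] from by decide]
    linear_combination h

/-- The algebraic leaf for `s = (5)` (at `Φ_KZ`: `ζ(5) = 6/5 ζ(2,3) + 4/5 ζ(3,2)`). [cite:
IharaKanekoZagier2006, §2] -/
theorem leafCert_w5_5 :
    ∃ b : List ℕ →₀ ℚ, (∀ t ∈ b.support, MZV.IsHoffman t ∧ MZV.weight t = MZV.weight [5]) ∧ ∀ (R :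
      Type) [CommRing R] [Algebra ℚ R] [IsReduced R] (φ : NCSeries Bool R), NCSeries.IsGroupLike φ →
      NCSeries.DrinfeldPentagon φ → φ (MZV.binaryWord [5]) = b.sum (fun t q => q • φ (MZV.binaryWord
      t)) :=
  leafCert_exists [5] 5 (by norm_num) [([2, 3], -6), ([3, 2], -4)] (by decide) fun R _ _ φ hg h5 =>
    by
    have h := leafNF_00001 hg h5
    simp only [List.map_cons, List.map_nil, List.sum_cons, List.sum_nil, add_zero]
    push_cast
    rw [show MZV.binaryWord [5] = [false, false, false, false, true] from by decide,
      show MZV.binaryWord [2, 3] = [false, true, false, false, true] from by decide,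
      show MZV.binaryWord [3, 2] = [false, false, true, false, true] from by decide]
    linear_combination h

/-- **The algebraic leaf `AssociatorHoffmanSpanning` in weight `5`**: for every admissible index `s` of
weight `5` one finitely supported `b` on Hoffman indices of weight `5` with
`c_{binaryWord s}(φ) = Σ_t b_t c_{binaryWord t}(φ)` at every group-like solution `φ` of Drinfeld's
pentagon over every (reduced) commutative `ℚ`-algebra — the weight-`5` slice of
`GRT₁ ≅ U^{dR}_{MT(ℤ)}` in coordinates — from Furusho's double shuffle for pentagon solutions and the
Ihara–Kaneko–Zagier regularised double shuffle linear algebra (`d_5 = 2`; reducedness is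
not used; Hoffman indices reduce to themselves). [cite: IharaKanekoZagier2006, §2] -/
theorem associatorHoffmanSpanning_of_weight_eq_5 {s : List ℕ} (hs : MZV.IsAdmissible s)
    (hw : MZV.weight s = 5) :
    ∃ b : List ℕ →₀ ℚ, (∀ t ∈ b.support, MZV.IsHoffman t ∧ MZV.weight t = MZV.weight s) ∧ ∀ (R :
      Type) [CommRing R] [Algebra ℚ R] [IsReduced R] (φ : NCSeries Bool R), NCSeries.IsGroupLike φ →
      NCSeries.DrinfeldPentagon φ → φ (MZV.binaryWord s) = b.sum (fun t q => q • φ (MZV.binaryWord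
      t)) := by
  obtain ⟨hpos, hhead⟩ := hs
  match s, hpos, hhead, hw with
  | [], _, _, hw => exact absurd hw (by decide)
  | [a], hpos, hhead, hw =>
    have ha : 2 ≤ a := hhead (by simp)
    have hw' : a = 5 := by simpa [MZV.weight] using hw
    have ha' : a ≤ 5 := by omega
    interval_cases a <;>
      first
        | omega
        | exact leafLowWeight_of_isHoffman (by decide)
        | exact leafCert_w5_5
  | [a, b], hpos, hhead, hw =>
    have ha : 2 ≤ a := hhead (by simp)
    have hb : 1 ≤ b := hpos b (by simp)
    have hw' : a + b = 5 := by simpa [MZV.weight] using hw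
    have ha' : a ≤ 4 := by omega
    have hb' : b ≤ 3 := by omega
    interval_cases a <;> interval_cases b <;>
      first
        | omega
        | exact leafLowWeight_of_isHoffman (by decide)
        | exact leafCert_w5_41
  | [a, b, c], hpos, hhead, hw =>
    have ha : 2 ≤ a := hhead (by simp)
    have hb : 1 ≤ b := hpos b (by simp)
    have hc : 1 ≤ c := hpos c (by simp)
    have hw' : a + (b + c) = 5 := by simpa [MZV.weight] using hw
    have ha' : a ≤ 3 := by omega
    have hb' : b ≤ 2 := by omega
    have hc' : c ≤ 2 := by omega
    interval_cases a <;> interval_cases b <;> interval_cases c <;>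
      first
        | omega
        | exact leafLowWeight_of_isHoffman (by decide)
        | exact leafCert_w5_212
        | exact leafCert_w5_221
        | exact leafCert_w5_311
  | [a, b, c, d], hpos, hhead, hw =>
    have ha : 2 ≤ a := hhead (by simp)
    have hb : 1 ≤ b := hpos b (by simp)
    have hc : 1 ≤ c := hpos c (by simp)
    have hd : 1 ≤ d := hpos d (by simp)
    have hw' : a + (b + (c + d)) = 5 := by simpa [MZV.weight] using hw
    obtain rfl : a = 2 := by omega
    obtain rfl : b = 1 := by omega
    obtain rfl : c = 1 := by omega
    obtain rfl : d = 1 := by omega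
    first
        | omega
        | exact leafLowWeight_of_isHoffman (by decide)
        | exact leafCert_w5_2111
  | a :: b :: c :: d :: e :: u, hpos, hhead, hw =>
    exfalso
    have ha : 2 ≤ a := hhead (by simp)
    have hb : 1 ≤ b := hpos b (by simp)
    have hc : 1 ≤ c := hpos c (by simp)
    have hd : 1 ≤ d := hpos d (by simp)
    have he : 1 ≤ e := hpos e (by simp)
    have hw' : a + (b + (c + (d + (e + u.sum)))) = 5 := by simpa [MZV.weight] using hw
    omega

/-- **Registered stub `stub_leafWeightFive`** of the lead's skeleton (crux stmt-KontsevichZagierPeriods-15058, line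
`Sketch`): the weight-`5` slice of the algebraic leaf `AssociatorHoffmanSpanning`, verbatim. [cite: IharaKanekoZagier2006, §2] -/
theorem stub_leafWeightFive : ∀ s : List ℕ, MZV.IsAdmissible s → MZV.weight s = 5 → ∃ b : List ℕ →₀ ℚ, (∀ t ∈ b.support, MZV.IsHoffman t ∧ MZV.weight t = MZV.weight s) ∧ ∀ (R : Type) [CommRing R] [Algebra ℚ R] [IsReduced R] (φ : NCSeries Bool R), NCSeries.IsGroupLike φ → NCSeries.DrinfeldPentagon φ → φ (MZV.binaryWord s) = b.sum (fun t q => q • φ (MZV.binaryWord t)) :=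
  fun _ hs hw => associatorHoffmanSpanning_of_weight_eq_5 hs hw

end Summit.KontsevichZagierPeriods.FurushoPentagon.KernelModuloPeriodConjecture
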